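import Summits.HodgeConjecture.CorCM.MultiFieldWeilUnitsRealised
import Summits.HodgeConjecture.CorCM.MultiFieldWeilUnitGram
import Summits.HodgeConjecture.CorCM.MultiFieldWeilTwinsMenuOctic
import HarnessLib

/-!
# MULTI-FIELD WEIL ENGINE — SEVERAL ISOGENY CLASSES PER FIELD INSIDE THE MENU: `E` + up to TWO simple CM threefolds per sextic field, up to THREE simple CM fourfolds per
# `𝔄₄`/`𝔖₄`-octic field, up to THREE `(2,3)`/`(3,2)` fivefolds per decic field, all through `k`, `Hom = ∅` across fields of equal degree — the Hodge conjecture for every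
# product of copies, given only Markman's fourfold and hyperbolic-sixfold theorems

Cell `pub-hodgecm2` (COR-CM), seat b30 gen 39 (2026-08-25); count-neutral own lane MULTI-FIELD WEIL ENGINE (stem `MultiFieldWeil*`), the geometric dress of the UNITS
programme: `…UnitSeparation` (U1: the cell identity; separation ⟸ linear independence of the centred indicators), `…UnitsDefectLaw` (U2), `…UnitsRealised` (U3:
`hodgeConjectureFor_biproduct_comp_of_units_frames`), `…UnitGram` (U5a: the independent triples), superseding the twin files (`…TwinsMenuOctic`, T4: two classes per field,
octic twins `(1,3)` only).  Theorems only; no definition, no named fact, no `sorry`.  HONEST FRAMING: conditional ONLY on the two displayed Markman binders; `HC_CM` is NOT proved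
and not asserted.  (Dominated form: compose with `Domination.hodgeConjectureFor_of_avDominatedBy`.)

**`hodgeConjectureFor_biproduct_comp_of_unitsMenu`.**  Slots `is : Fin r → I` over CM fields `Kf i ⊇ iK i (k)`, `k = Kf i₀` imaginary quadratic, `n_m = nI (is m) ∈ {3, 4, 5}`,
`E = A 0 ⊨ (k; {τ})`, `B_m = A (m+1) ⊨ (K_{is m}; Φ (m+1))`; slots with the SAME index are structures over the SAME field (a UNIT).  HYPOTHESES: `B_m` SIMPLE for `n_m ∈ {3,4}`,
of `k`-signature `(2,3)`/`(3,2)` for `n_m = 5`; the slots of a unit pairwise NON-ISOGENOUS; at most `2` slots per sextic index, at most `3` per octic or decic index; in an octic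
unit of `3` slots a slot of `k`-signature `(2,2)` has a second one (`h22`); every octic field with two `τ`-embeddings generating degree `24` with `τ(k)` (quartic part `𝔄₄`/`𝔖₄`);
every decic index with `≥ 2` slots with two `τ`-embeddings generating degree `40` (quintic part `2`-transitive); `Hom(K_i, K_{i'}) = ∅` for different indices of equal degree; for
`K_{i'}` octic and `K_i` sextic a `τ`-embedding of `K_i` with a value outside `L(K_{i'})`.  THEN the Hodge conjecture holds for EVERY product of copies `⨁_j A(κ j)`, GIVEN ONLY
Markman's two theorems.  In words, per field through `k`: sextic — any `≤ 2` isogeny classes of simple threefolds; `𝔄₄`/`𝔖₄`-octic — any `≤ 3` classes of simple fourfolds except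
«two `(1,3)`-classes with exactly one `(2,2)`-class»; decic with `2`-transitive quintic part — any `≤ 3` classes of `(2,3)`/`(3,2)`-fivefolds.  NOT covered, honestly (centred
indicators DEPENDENT, or no Markman input): `B_q, B_{q'}` of signature `(1,3)` with the `(2,2)`-class at `{q,q'}` (the case `h22` excludes together with its harmless twin
«`(2,2)`-class elsewhere»); four classes over one octic or decic field; three over one sextic field; `(1,4)`-fivefolds; imprimitive quartic parts (`…ClosureDisjointSlots`).

PROOF.  One SIGN frame per index; types normalised (`exists_realisations_card_eq_of_or`); units = fibres of `is`; realised tuples diagonal on units; `2`-transitive on units with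
two slots (sextic: T4 §1; octic: degree `24`; decic: degree `40`); independence of a unit's centred indicators: Shimura's criterion (`P' ∉ {P, Pᶜ}`) + U1 (two sets), U2 §2
(three singletons), U5a (`2`-sets meeting once ∕ with a singleton ∕ three `2`-sets on five letters); stabiliser-transitivity across units from `Hom = ∅`; U3 + Markman.

[cite: Markman2025SurveySecant, Thm. 1.2] [cite: Markman2025SecantWeil, Thm 1.5.1] [cite: Shimura1998, §6.1 Corollary of Theorem 2, §8.2 Prop. 26, §8.4, §18.2 Lemma (i)]
[cite: Deligne1982HodgeCycles, §5 (b)] [cite: Lang2002, VI §1 Thm. 1.14 and V §2 Thm. 2.8; XIII §4; XV §1] [cite: MoonenZarhin1995Duke, Thm. 2.4] [cite: Pohlmann1968, Thm 1]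
[cite: DixonMortimer1996, §1.4 Ex. 1.4.1–1.4.2; §1.6, Thm. 1.6A; §2.1; §3.3, Thm. 3.3A] [cite: Dodson1984, §1.1 Imprimitivity Theorem and §5.1.2 Theorem] [cite: MumfordAV1970, §19]

## References
* [Markman2025SurveySecant] E. Markman, arXiv:2509.23403, Thm. 1.2.  [Markman2025SecantWeil] E. Markman, Cycles on abelian 2n-folds of Weil type from secant sheaves on abelian
  n-folds, Thm 1.5.1.  [Shimura1998] G. Shimura, *Abelian varieties with complex multiplication and modular functions*, §6.1, §8.2, §8.4, §18.2.  [Deligne1982HodgeCycles]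
  P. Deligne, LNM 900, §5 (b).  [Lang2002] S. Lang, *Algebra*, GTM 211, V §2, VI §1, XIII §4, XV §1.  [MoonenZarhin1995Duke] B. Moonen, Yu. Zarhin, Duke Math. J. 77 (1995),
  Thm. 2.4.  [Pohlmann1968] H. Pohlmann, Ann. of Math. 88 (1968), Thm 1.  [DixonMortimer1996] J. D. Dixon, B. Mortimer, *Permutation Groups*, GTM 163.  [Dodson1984] B. Dodson,
  Trans. AMS 283 (1984).  [MumfordAV1970] D. Mumford, *Abelian Varieties*, §19.
-/

noncomputable section

open CategoryTheory CategoryTheory.Limits NumberField IntermediateField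

namespace Summit.HodgeConjecture.CorCM.MultiFieldWeil

open Finset
open Literature.AlgebraicGeometry Literature.AlgebraicGeometry.Motives Literature.AlgebraicGeometry.HodgeTheory
open Literature.AlgebraicGeometry.ComplexMultiplication (IsCMTypeRealisation)
open Literature.AlgebraicTopology.SingularHomology
open Literature.NumberTheory.ComplexMultiplication
open Summit.HodgeConjecture.CorCM.Census.MultiFieldWeil

open scoped Classical

/-! ## The menu with several isogeny classes per field -/

/-- The complement of a cast image is the cast image of the complement. [folklore] -/
theorem compl_image_cast {n n' : ℕ} (h : n' = n) (S : Finset (Fin n')) : (S.image (Fin.cast h))ᶜ = Sᶜ.image (Fin.cast h) := by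
  subst h; rw [image_cast_self, image_cast_self]

section UnitsMenu

variable {I : Type} {r : ℕ} {Kf : I → Type} [∀ i, Field (Kf i)] [∀ i, NumberField (Kf i)] [∀ i, IsCMField (Kf i)]
  {i₀ : I} {is : Fin r → I} {τ : Kf i₀ →+* ℂ}
  {A : Fin (r + 1) → AbelianVariety ℂ} {Φ : ∀ j : Fin (r + 1), CMType (Kf (mfSlots i₀ is j))}
  {ι : ∀ j, 𝓞 (Kf (mfSlots i₀ is j)) →+* End (A j)}
  {θ : ∀ j, Kf (mfSlots i₀ is j) →+* Module.End ℂ (complexBetti (A j).X 1)}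

/-- **SEVERAL ISOGENY CLASSES PER FIELD INSIDE THE NON-ISOMORPHIC MENU — GIVEN ONLY MARKMAN'S FOURFOLD AND HYPERBOLIC-SIXFOLD THEOREMS.**  See the module docstring.
`HC_CM` is NOT asserted. [cite: Markman2025SurveySecant, Thm. 1.2] [cite: Markman2025SecantWeil, Thm 1.5.1] [cite: Shimura1998, §6.1 Corollary of Theorem 2, §8.2 Prop. 26, §18.2]
[cite: Deligne1982HodgeCycles, §5 (b)] [cite: DixonMortimer1996, §1.4 Ex. 1.4.1–1.4.2; §1.6, Thm. 1.6A; §2.1; §3.3, Thm. 3.3A] [cite: Dodson1984, §1.1 Imprimitivity Theorem and §5.1.2 Theorem]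
[cite: Lang2002, XIII §4] -/
theorem hodgeConjectureFor_biproduct_comp_of_unitsMenu (hW4 : Markman2025_weilClasses_algebraic_abelianFourfold)
    (hM6 : Markman2025_weilClasses_algebraic_hyperbolicSixfold) {N : ℕ} (κ : Fin N → Fin (r + 1)) (h2 : Module.finrank ℚ (Kf i₀) = 2) (nI : I → ℕ)
    (hnI : ∀ m : Fin r, nI (is m) = 3 ∨ nI (is m) = 4 ∨ nI (is m) = 5) (hdeg : ∀ m : Fin r, Module.finrank ℚ (Kf (is m)) = 2 * nI (is m))
    (iK : ∀ i : I, Kf i₀ →+* Kf i) (hA : ∀ j, IsCMTypeRealisation (Φ j) (A j) (ι j) (θ j)) (hΨ : ∀ σ : Kf i₀ →+* ℂ, σ ∈ (Φ 0).1 ↔ σ = τ)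
    (hS : ∀ m : Fin r, nI (is m) = 3 ∨ nI (is m) = 4 → (A m.succ).IsSimple)
    (h23 : ∀ m : Fin r, nI (is m) = 5 → (Finset.univ.filter fun s : Kf (is m) →+* ℂ => s.comp (iK (is m)) = τ ∧ s ∈ (Φ m.succ).1).card = 2 ∨
      (Finset.univ.filter fun s : Kf (is m) →+* ℂ => s.comp (iK (is m)) = τ ∧ s ∈ (Φ m.succ).1).card = 3)
    (hni : ∀ m m' : Fin r, m' ≠ m → is m' = is m → ¬ AbelianVariety.IsIsogenous (A m.succ) (A m'.succ))
    (hfib : ∀ m : Fin r, (Finset.univ.filter fun m' : Fin r => is m' = is m).card ≤ if nI (is m) = 3 then 2 else 3)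
    (h22 : ∀ m : Fin r, nI (is m) = 4 → 2 < (Finset.univ.filter fun m' : Fin r => is m' = is m).card →
      (Finset.univ.filter fun s : Kf (is m) →+* ℂ => s.comp (iK (is m)) = τ ∧ s ∈ (Φ m.succ).1).card = 2 →
      ∃ m' : Fin r, m' ≠ m ∧ is m' = is m ∧ (Finset.univ.filter fun s : Kf (is m') →+* ℂ => s.comp (iK (is m')) = τ ∧ s ∈ (Φ m'.succ).1).card = 2)
    (h24 : ∀ m : Fin r, nI (is m) = 4 → ∃ s₀ t₀ : Kf (is m) →+* ℂ, s₀.comp (iK (is m)) = τ ∧ t₀.comp (iK (is m)) = τ ∧ s₀ ≠ t₀ ∧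
      Module.finrank ℚ ↥(adjoin ℚ (Set.range τ) ⊔ adjoin ℚ (Set.range s₀ ∪ Set.range t₀)) = 24)
    (h40 : ∀ m : Fin r, nI (is m) = 5 → 1 < (Finset.univ.filter fun m' : Fin r => is m' = is m).card → ∃ s₀ t₀ : Kf (is m) →+* ℂ,
      s₀.comp (iK (is m)) = τ ∧ t₀.comp (iK (is m)) = τ ∧ s₀ ≠ t₀ ∧ Module.finrank ℚ ↥(adjoin ℚ (Set.range τ) ⊔ adjoin ℚ (Set.range s₀ ∪ Set.range t₀)) = 40)
    (hiso : ∀ m₀ m : Fin r, is m ≠ is m₀ → nI (is m₀) = nI (is m) → IsEmpty (Kf (is m) →+* Kf (is m₀)))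
    (hout43 : ∀ m₀ m : Fin r, nI (is m₀) = 4 → nI (is m) = 3 → ∃ s : Kf (is m) →+* ℂ, s.comp (iK (is m)) = τ ∧ ∃ x, s x ∉ normalClosure ℚ (Kf (is m₀)) ℂ) :
    HodgeConjectureFor (⨁ fun j => A (κ j)).dim (⨁ fun j => A (κ j)).X := by
  have hττ : ComplexEmbedding.conjugate τ ≠ τ := QuarticCM.conjugate_ne τ
  have hk : ∀ σ : Kf i₀ →+* ℂ, σ = τ ∨ σ = ComplexEmbedding.conjugate τ := fun σ => QuarticCM.eq_or_eq_conjugate_of_quadratic h2 τ σ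
  obtain ⟨δ₀, d, hd, hδ₀⟩ := CyclicSextic.exists_sq_eq_neg_nat_of_isTotallyComplex (Kf i₀) h2
  obtain ⟨δ, hδ, hτ⟩ := OcticCurveFourfold.exists_delta_of_mem h2 hd hδ₀ τ
  let im : ∀ m : Fin r, Kf i₀ →+* Kf (is m) := fun m => iK (is m)
  have hnn : ∀ {m m' : Fin r}, is m' = is m → nI (is m') = nI (is m) := fun h => congrArg nI h
  -- (0) transports across an equality of indices, by substitution
  have castT : ∀ i j : I, i = j → ∀ (Ψ : CMType (Kf i)) (B : AbelianVariety ℂ) (ιB : 𝓞 (Kf i) →+* End B)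
      (θB : Kf i →+* Module.End ℂ (complexBetti B.X 1)), IsCMTypeRealisation Ψ B ιB θB →
      ∃ (Ψ₂ : CMType (Kf j)) (ι₂ : 𝓞 (Kf j) →+* End B) (θ₂ : Kf j →+* Module.End ℂ (complexBetti B.X 1)), HEq Ψ₂ Ψ ∧ IsCMTypeRealisation Ψ₂ B ι₂ θ₂ := by
    intro i j h; subst h; exact fun Ψ B ιB θB hB => ⟨Ψ, ιB, θB, HEq.rfl, hB⟩
  have countT : ∀ i j : I, i = j → ∀ (Ψ : CMType (Kf i)) (Ψ₂ : CMType (Kf j)), HEq Ψ₂ Ψ → (Finset.univ.filter fun s : Kf i →+* ℂ => s.comp (iK i) = τ ∧ s ∈ Ψ.1).card =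
      (Finset.univ.filter fun s : Kf j →+* ℂ => s.comp (iK j) = τ ∧ s ∈ Ψ₂.1).card := by
    intro i j h; subst h; intro Ψ Ψ₂ hh; cases hh; rfl
  -- (1) the normalised counts and structures: threefolds `1`, fourfolds `1` or `2`, fivefolds `2`
  have hex : ∀ m : Fin r, ∃ pm : ℕ, pm ≤ nI (is m) ∧ ((nI (is m) = 3 ∧ pm = 1) ∨ (nI (is m) = 4 ∧ pm = 1) ∨ (nI (is m) = 4 ∧ pm = 2) ∨ (nI (is m) = 5 ∧ pm = 2)) ∧
      ((Finset.univ.filter fun s : Kf (is m) →+* ℂ => s.comp (im m) = τ ∧ s ∈ (Φ m.succ).1).card = pm ∨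
        (Finset.univ.filter fun s : Kf (is m) →+* ℂ => s.comp (im m) = τ ∧ s ∈ (Φ m.succ).1).card = nI (is m) - pm) := fun m => by
    rcases hnI m with h | h | h
    · refine ⟨1, by rw [h]; norm_num, Or.inl ⟨h, rfl⟩, ?_⟩
      rcases card_filter_mem_eq_one_or_two_of_isSimple (by rw [hdeg m, h]) h2 (im m) (hA m.succ) (hS m (Or.inl h)) τ with hc | hc
      exacts [Or.inl hc, Or.inr (hc.trans (by rw [h] : nI (is m) - 1 = 2).symm)]
    · rcases card_filter_mem_octic_of_isSimple (by rw [hdeg m, h]) h2 (im m) (hA m.succ) (hS m (Or.inr h)) τ with hc | hc | hc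
      · exact ⟨1, by rw [h]; norm_num, Or.inr (Or.inl ⟨h, rfl⟩), Or.inl hc⟩
      · exact ⟨2, by rw [h]; norm_num, Or.inr (Or.inr (Or.inl ⟨h, rfl⟩)), Or.inl hc⟩
      · exact ⟨1, by rw [h]; norm_num, Or.inr (Or.inl ⟨h, rfl⟩), Or.inr (hc.trans (by rw [h] : nI (is m) - 1 = 3).symm)⟩
    · refine ⟨2, by rw [h]; norm_num, Or.inr (Or.inr (Or.inr ⟨h, rfl⟩)), ?_⟩
      rcases h23 m h with hc | hc
      exacts [Or.inl hc, Or.inr (hc.trans (by rw [h] : nI (is m) - 2 = 3).symm)]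
  choose p hpn hnp hor using hex
  obtain ⟨Φ', ι', θ', hA', h0, hp⟩ := exists_realisations_card_eq_of_or (n := fun m => nI (is m)) (Φ := Φ) h2 hdeg im hA p hpn hor
  have hΨ' : ∀ σ : Kf i₀ →+* ℂ, σ ∈ (Φ' 0).1 ↔ σ = τ := by rw [h0]; exact hΨ
  have hn0 : ∀ m, 0 < nI (is m) := fun m => by rcases hnI m with h | h | h <;> rw [h] <;> norm_num
  have hexs : ∀ m : Fin r, ∃ s : Kf (is m) →+* ℂ, s.comp (im m) = τ := fun m => by
    have hc := SexticOcticWeil.card_filter_comp_eq_of_finrank (n := nI (is m)) (im m) (hdeg m) h2 τ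
    obtain ⟨s, hs⟩ := Finset.card_pos.1 (by rw [hc]; exact hn0 m)
    exact ⟨s, (Finset.mem_filter.1 hs).2⟩
  -- (2) the units: a representative map for the fibres of `is`
  obtain ⟨U, hU⟩ := exists_unitRep is
  have hcardU : ∀ m, Fintype.card {m' : Fin r // U m' = U m} = (Finset.univ.filter fun m' : Fin r => is m' = is m).card := fun m => by
    rw [Fintype.card_subtype]; exact congrArg Finset.card (Finset.ext fun x => by simp only [Finset.mem_filter, Finset.mem_univ, true_and, hU])
  -- (3) ONE SIGN FRAME PER INDEX
  have hfr : ∀ (i : I) (ni : ℕ), Module.finrank ℚ (Kf i) = 2 * ni → ∃ E : (Kf i →+* ℂ) ≃ Fin ni × Bool,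
      (∀ s, (E s).2 = true ↔ s.comp (iK i) = τ) ∧ ∀ s, E (ComplexEmbedding.conjugate s) = ((E s).1, !(E s).2) := fun i ni hdi => exists_signFrame hdi h2 (iK i) hττ hk
  choose E hE_sign hE_conj using hfr
  have readT : ∀ i j : I, ∀ h : j = i, ∀ (hi : Module.finrank ℚ (Kf i) = 2 * nI i) (hj : Module.finrank ℚ (Kf j) = 2 * nI j) (Ψ : CMType (Kf i)) (Ψ₂ : CMType (Kf j))
      (Q : Finset (Fin (nI j))), HEq Ψ Ψ₂ → (∀ s, s ∈ Ψ₂.1 ↔ (E j (nI j) hj s).2 = decide ((E j (nI j) hj s).1 ∈ Q)) →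
      ∀ s, s ∈ Ψ.1 ↔ (E i (nI i) hi s).2 = decide ((E i (nI i) hi s).1 ∈ Q.image (Fin.cast (congrArg nI h))) := by
    intro i j h; subst h; intro hi hj Ψ Ψ₂ Q hh hr; have hΨ : Ψ = Ψ₂ := eq_of_heq hh; subst hΨ; rw [image_cast_self]; exact hr
  have diagT : ∀ i j : I, ∀ h : i = j, ∀ (hi : Module.finrank ℚ (Kf i) = 2 * nI i) (hj : Module.finrank ℚ (Kf j) = 2 * nI j) (ρ : ℂ →+* ℂ)
      (a : Fin (nI i)) (x : Fin (nI i)) (y : Fin (nI j)),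
      ρ.comp ((E i (nI i) hi).symm (a, true)) = (E i (nI i) hi).symm (x, true) →
      ρ.comp ((E j (nI j) hj).symm (Fin.cast (congrArg nI h) a, true)) = (E j (nI j) hj).symm (y, true) → Fin.cast (congrArg nI h) x = y := by
    intro i j h; subst h; intro hi hj ρ a x y h₁ h₂
    rw [(Fin.ext rfl : Fin.cast (congrArg nI (rfl : i = i)) a = a)] at h₂
    exact (Fin.ext rfl : Fin.cast _ x = x).trans (Prod.mk.inj ((E i (nI i) hi).symm.injective (h₁.symm.trans h₂))).1
  -- (4) the frames of the slots, their readings and position sets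
  let e : ∀ m : Fin r, (Kf (is m) →+* ℂ) ≃ Fin (nI (is m)) × Bool := fun m => E (is m) (nI (is m)) (hdeg m)
  have he_sign : ∀ (m : Fin r) (s : Kf (is m) →+* ℂ), (e m s).2 = true ↔ s.comp (im m) = τ := fun m => hE_sign (is m) (nI (is m)) (hdeg m)
  have he_conj : ∀ (m : Fin r) (s : Kf (is m) →+* ℂ), e m (ComplexEmbedding.conjugate s) = ((e m s).1, !(e m s).2) := fun m => hE_conj (is m) (nI (is m)) (hdeg m)
  let P : ∀ m : Fin r, Finset (Fin (nI (is m))) := fun m => Finset.univ.filter fun a : Fin (nI (is m)) => (e m).symm (a, true) ∈ (Φ' m.succ).1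
  have hΦ : ∀ (m : Fin r) (s : Kf (is m) →+* ℂ), s ∈ (Φ' m.succ).1 ↔ (e m s).2 = decide ((e m s).1 ∈ P m) := fun m s =>
    mem_iff_snd_eq_decide_mem_posSet (he_conj m) (Φ' m.succ) s
  have hcard : ∀ m : Fin r, (P m).card = p m := fun m => (card_posSet (he_sign m) (Φ' m.succ)).trans (hp m)
  -- the partner structures of a unit, transported to the slot's own field and read through the cast
  have hpartner : ∀ (m m' : Fin r) (h : is m' = is m), ∃ (Ψ₂ : CMType (Kf (is m))) (ι₂ : 𝓞 (Kf (is m)) →+* End (A m'.succ))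
      (θ₂ : Kf (is m) →+* Module.End ℂ (complexBetti (A m'.succ).X 1)), IsCMTypeRealisation Ψ₂ (A m'.succ) ι₂ θ₂ ∧
      (Finset.univ.filter fun s : Kf (is m) →+* ℂ => s.comp (im m) = τ ∧ s ∈ Ψ₂.1).card = p m' ∧
      ∀ s, s ∈ Ψ₂.1 ↔ (e m s).2 = decide ((e m s).1 ∈ (P m').image (Fin.cast (hnn h))) := by
    intro m m' h
    obtain ⟨Ψ₂, ι₂, θ₂, hh₂, hA₂⟩ := castT _ _ h (Φ' m'.succ) (A m'.succ) (ι' m'.succ) (θ' m'.succ) (hA' m'.succ)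
    exact ⟨Ψ₂, ι₂, θ₂, hA₂, (countT _ _ h (Φ' m'.succ) Ψ₂ hh₂).symm.trans (hp m'),
      readT _ _ h (hdeg m) (hdeg m') Ψ₂ (Φ' m'.succ) (P m') hh₂ (hΦ m')⟩
  -- two slots of one unit: position sets neither equal nor complementary (Shimura's isogeny criterion)
  have hdist : ∀ (m m' : Fin r) (h : is m' = is m), m' ≠ m → (P m').image (Fin.cast (hnn h)) ≠ P m ∧ (P m').image (Fin.cast (hnn h)) ≠ (P m)ᶜ := by
    intro m m' h hne
    obtain ⟨Ψ₂, ι₂, θ₂, hA₂, -, hr₂⟩ := hpartner m m' h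
    have hsh := DihedralSexticPair.cmType_ne_and_ne_compl_of_not_isIsogenous (hA' m.succ) hA₂ (hni m m' hne h)
    refine ⟨fun hq => hsh.1 (Set.ext fun s => (hΦ m s).trans (by rw [← hq]; exact (hr₂ s).symm)), fun hq => hsh.2 (Set.ext fun s => ?_)⟩
    have hX : ((e m s).2 = decide ((e m s).1 ∈ (P m').image (Fin.cast (hnn h)))) ↔ ¬ ((e m s).2 = decide ((e m s).1 ∈ P m)) :=
      eq_decide_iff_not_eq_decide (by rw [hq, Finset.mem_compl])
    exact (hr₂ s).trans ((hX.trans (not_congr (hΦ m s)).symm).trans (Set.mem_compl_iff _ _).symm)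
  -- (5) the realised tuples are DIAGONAL on every unit
  have hdg : ∀ π ∈ realisedTuples e τ, ∀ (m m' : Fin r) (h : U m' = U m) (a : Fin (nI (is m'))),
      Fin.cast (hnn ((hU m m').1 h)) (π m' a) = π m (Fin.cast (hnn ((hU m m').1 h)) a) := by
    intro π hπ m m' h a; obtain ⟨ρ, -, hρ⟩ := (mem_realisedTuples e τ π).1 hπ
    exact diagT _ _ ((hU m m').1 h) (hdeg m') (hdeg m) (ρ : ℂ →+* ℂ) a (π m' a) (π m (Fin.cast _ a)) (hρ m' a) (hρ m (Fin.cast _ a))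
  -- (6) `2`-transitivity: octic slots by degree `24`; units with two slots — sextic by T4 §1, decic by degree `40`
  have h2T4 : ∀ m, nI (is m) = 4 → ∀ s₁ s₂ s₁' s₂' : Kf (is m) →+* ℂ, s₁.comp (im m) = τ → s₂.comp (im m) = τ → s₁'.comp (im m) = τ → s₂'.comp (im m) = τ →
      s₁ ≠ s₂ → s₁' ≠ s₂' → ∃ ρ : ℂ ≃+* ℂ, (ρ : ℂ →+* ℂ).comp τ = τ ∧ (ρ : ℂ →+* ℂ).comp s₁ = s₁' ∧ (ρ : ℂ →+* ℂ).comp s₂ = s₂' := fun m h4 =>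
    h2T_of_finrank_pair_octic h2 im hdeg h24 m h4
  have h2t4 : ∀ m, nI (is m) = 4 → ∀ a b a' b' : Fin (nI (is m)), a ≠ b → a' ≠ b' → ∃ π ∈ realisedTuples e τ, π m a = a' ∧ π m b = b' := fun m h4 =>
    twoTransitive_realisedTuples_of_aut (e := e) he_sign m (h2T4 m h4)
  have hp1_3 : ∀ m, nI (is m) = 3 → p m = 1 := fun m h3m => by
    rcases hnp m with ⟨-, h⟩ | ⟨h, -⟩ | ⟨h, -⟩ | ⟨h, -⟩ <;> omega
  have h2t : ∀ m, (∃ m', m' ≠ m ∧ U m' = U m) → ∀ a a' b b' : Fin (nI (is m)), a ≠ a' → b ≠ b' → ∃ π ∈ realisedTuples e τ, π m a = b ∧ π m a' = b' := by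
    intro m hm; obtain ⟨m', hm'm, hUm'⟩ := hm
    have him : is m' = is m := (hU m m').1 hUm'
    rcases hnI m with h3m | h4 | h5
    · -- sextic: two non-isogenous simple threefolds over the field
      obtain ⟨Ψ₂, ι₂, θ₂, hA₂, hone₂, -⟩ := hpartner m m' him
      exact twoTransitive_realisedTuples_of_aut (e := e) he_sign m
        (twoTransitive_aut_of_sextic_twins (by rw [hdeg m, h3m]) h2 (im m) τ (hA' m.succ) hA₂ (hS m (Or.inl h3m))
          (hS m' (Or.inl (by rw [him]; exact h3m))) (hni m m' hm'm him) ((hp m).trans (hp1_3 m h3m)) (hone₂.trans (hp1_3 m' (by rw [him]; exact h3m))))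
    · exact h2t4 m h4
    · -- decic: degree `40`
      have hlt : 1 < (Finset.univ.filter fun x : Fin r => is x = is m).card :=
        Finset.one_lt_card.2 ⟨m, by simp, m', by simp [him], hm'm.symm⟩
      obtain ⟨s₀, t₀, hs₀, ht₀, hst₀, hd40⟩ := h40 m h5 hlt
      exact twoTransitive_realisedTuples_of_aut (e := e) he_sign m
        (twoTransitive_aut_of_finrank_pair h2 im m (nm := 5) (by rw [hdeg m, h5]) hs₀ ht₀ hst₀ (by rw [hd40]))
  -- (7) stabiliser-transitivity across units: `Hom = ∅` within each degree (W1, the 𝔖₄ lemma, Y1), a value outside for octic → sextic, free otherwise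
  have hout : ∀ m₀ m : Fin r, is m ≠ is m₀ → (nI (is m₀) = nI (is m) ∨ (nI (is m₀) = 4 ∧ nI (is m) = 3)) →
      ∃ s : Kf (is m) →+* ℂ, s.comp (im m) = τ ∧ ∃ x, s x ∉ normalClosure ℚ (Kf (is m₀)) ℂ := by
    intro m₀ m hne hnm; obtain ⟨s, hs⟩ := hexs m
    rcases hnm with heq | ⟨h4₀, h3⟩
    · rcases hnI m with h3 | h4 | h5
      · exact ⟨s, hs, exists_apply_not_mem_normalClosure_of_isEmpty_ringHom h2 im (by rw [hdeg m₀, heq, h3]) (by rw [hdeg m, h3]) (hiso m₀ m hne heq) s hs⟩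
      · exact exists_outside_normalClosure_of_isEmpty_ringHom_four (n := fun l => nI (is l)) h2 hdeg im m₀ m (heq.trans h4) h4 (h2T4 m₀ (heq.trans h4))
          (hiso m₀ m hne heq)
      · exact ⟨s, hs, exists_apply_not_mem_normalClosure_of_isEmpty_ringHom_five h2 im (by rw [hdeg m₀, heq, h5]) (by rw [hdeg m, h5]) (hiso m₀ m hne heq) s hs⟩
    · exact hout43 m₀ m h4₀ h3
  have hstab₀ : ∀ (m₀ m : Fin r), is m ≠ is m₀ → ∀ a a' : Fin (nI (is m)), ∃ ν ∈ realisedTuples e τ, ν m₀ = 1 ∧ ν m a = a' := by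
    intro m₀ m hne a a'
    rcases hnI m with h3 | h4 | h5
    · rcases hnI m₀ with h3₀ | h4₀ | h5₀
      · exact stabTransitive_realisedTuples_of_outside_prime (e := e) he_sign m₀ m (by rw [h3]; exact Nat.prime_three) (hout m₀ m hne (Or.inl (h3₀.trans h3.symm))) a a'
      · exact stabTransitive_realisedTuples_of_outside_prime (e := e) he_sign m₀ m (by rw [h3]; exact Nat.prime_three) (hout m₀ m hne (Or.inr ⟨h4₀, h3⟩)) a a'
      · exact stabTransitive_realisedTuples_of_sizes_three_five (e := e) he_sign m₀ m (Or.inl ⟨h5₀, h3⟩) a a'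
    · rcases hnI m₀ with h3₀ | h4₀ | h5₀
      · exact stabTransitive_realisedTuples_into_four (e := e) he_sign m₀ m (Or.inl h3₀) h4 (h2t4 m h4) a a'
      · exact stabTransitive_realisedTuples_of_outside_twoTransitive (e := e) he_sign m₀ m (h2t4 m h4) (hout m₀ m hne (Or.inl (h4₀.trans h4.symm))) a a'
      · exact stabTransitive_realisedTuples_into_four (e := e) he_sign m₀ m (Or.inr h5₀) h4 (h2t4 m h4) a a'
    · rcases hnI m₀ with h3₀ | h4₀ | h5₀
      · exact stabTransitive_realisedTuples_of_sizes_three_five (e := e) he_sign m₀ m (Or.inr ⟨h3₀, h5⟩) a a'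
      · exact stabTransitive_realisedTuples_into_five_of_four (e := e) he_sign m₀ m h4₀ h5 a a'
      · exact stabTransitive_realisedTuples_of_outside_prime (e := e) he_sign m₀ m (by rw [h5]; exact Nat.prime_five) (hout m₀ m hne (Or.inl (h5₀.trans h5.symm))) a a'
  have hstab : ∀ (m₀ m : Fin r), U m₀ ≠ U m → ∀ a a' : Fin (nI (is m)), ∃ ν ∈ realisedTuples e τ, (∀ m', U m' = U m₀ → ν m' = 1) ∧ ν m a = a' := by
    intro m₀ m hne a a'
    obtain ⟨ν, hν, hν0, hνa⟩ := hstab₀ m₀ m (fun h => hne ((hU m m₀).2 h.symm)) a a'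
    refine ⟨ν, hν, fun m' hm' => Equiv.ext fun b => ?_, hνa⟩
    have hb := hdg ν hν m₀ m' hm' b; rw [hν0, Equiv.Perm.one_apply] at hb
    rw [Equiv.Perm.one_apply]; exact Fin.ext (by simpa only [Fin.val_cast] using congrArg Fin.val hb)
  -- (8) the slot menu on the single slots
  have hkind : ∀ m : Fin r, (∀ m', U m' = U m → m' = m) → (nI (is m)).Prime ∨ p m = 1 ∨
      ∀ Q : Finset (Fin (nI (is m))), Q.card = p m → ∃ π ∈ realisedTuples e τ, preG (π m) (P m) = Q := by
    intro m _
    rcases hnp m with ⟨h, -⟩ | ⟨-, h'⟩ | ⟨h, h'⟩ | ⟨h, -⟩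
    · exact Or.inl (by rw [h]; exact Nat.prime_three)
    · exact Or.inr (Or.inl h')
    · have hhom := homogeneous_two_of_twoTransitive (R := realisedTuples e τ) (P := P) (m := m) (by rw [hcard m, h']) (h2t4 m h)
      exact Or.inr (Or.inr fun Q hQ => hhom Q (by rw [hQ, hcard m]))
    · exact Or.inl (by rw [h]; exact Nat.prime_five)
  -- (9) the centred indicators of every unit with two or three slots are linearly independent (U1 two sets; U2 §2 singletons; U5a the Gram patterns)
  have hP0 : ∀ m, (P m).Nonempty := fun m => Finset.card_pos.1 (by rw [hcard m]; rcases hnp m with ⟨-, h⟩ | ⟨-, h⟩ | ⟨-, h⟩ | ⟨-, h⟩ <;> rw [h] <;> norm_num)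
  have hPn : ∀ m, (P m).card < nI (is m) := fun m => by
    rw [hcard m]; rcases hnp m with ⟨h, h'⟩ | ⟨h, h'⟩ | ⟨h, h'⟩ | ⟨h, h'⟩ <;> rw [h, h'] <;> norm_num
  have hli : ∀ m, (∃ m', m' ≠ m ∧ U m' = U m) → LinearIndependent ℚ fun m' : {m' : Fin r // U m' = U m} => fun q : Fin (nI (is m)) =>
      ((nI (is m) : ℚ) * (if q ∈ (P m'.1).image (Fin.cast (hnn ((hU m m'.1).1 m'.2))) then 1 else 0) - (P m'.1).card) := by
    intro m hm; obtain ⟨m', hm'm, hUm'⟩ := hm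
    have him : is m' = is m := (hU m m').1 hUm'
    have hix : ∀ x : {x : Fin r // U x = U m}, is x.1 = is m := fun x => (hU m x.1).1 x.2
    have hmemF : ∀ x : {x : Fin r // U x = U m}, x.1 ∈ Finset.univ.filter fun y : Fin r => is y = is m := fun x => by
      simp only [Finset.mem_filter, Finset.mem_univ, true_and]; exact hix x
    -- the position sets of the unit read in `Fin (nI (is m))`; the cardinalities of the original sets equal those of the images
    let Q : {x : Fin r // U x = U m} → Finset (Fin (nI (is m))) := fun x => (P x.1).image (Fin.cast (hnn (hix x)))
    have hQcard : ∀ x, (Q x).card = p x.1 := fun x => by simp only [Q, Finset.card_image_of_injective _ (Fin.cast_injective _), hcard]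
    have hfun : (fun m'' : {m'' : Fin r // U m'' = U m} => fun q : Fin (nI (is m)) =>
        ((nI (is m) : ℚ) * (if q ∈ (P m''.1).image (Fin.cast (hnn ((hU m m''.1).1 m''.2))) then 1 else 0) - (P m''.1).card)) =
        fun m'' : {m'' : Fin r // U m'' = U m} => fun q : Fin (nI (is m)) => ((nI (is m) : ℚ) * (if q ∈ Q m'' then 1 else 0) - (Q m'').card) := by
      funext m'' q
      rw [hQcard, hcard]
    rw [hfun]
    -- distinct slots of the unit read neither equal nor complementary sets
    have hQne : ∀ x x' : {x : Fin r // U x = U m}, x' ≠ x → Q x' ≠ Q x ∧ Q x' ≠ (Q x)ᶜ := by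
      intro x x' hne
      have hne1 : x'.1 ≠ x.1 := fun h => hne (Subtype.ext h)
      have hixx : is x'.1 = is x.1 := (hix x').trans (hix x).symm
      have hd := hdist x.1 x'.1 hixx hne1
      have hcomp : Q x' = ((P x'.1).image (Fin.cast (hnn hixx))).image (Fin.cast (hnn (hix x))) := by
        show (P x'.1).image _ = _
        rw [Finset.image_image]
        rfl
      refine ⟨fun h => hd.1 (Finset.image_injective (Fin.cast_injective (hnn (hix x))) ?_), fun h => hd.2 (Finset.image_injective (Fin.cast_injective (hnn (hix x))) ?_)⟩
      · rw [← hcomp]; exact h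
      · rw [← hcomp, h, ← compl_image_cast]
    -- a unit never has four slots: three pairwise distinct members exhaust it
    have henum : (Finset.univ.filter fun y : Fin r => is y = is m).card ≤ 3 → ∀ x₀ x₁ x₂ : {x : Fin r // U x = U m}, x₀ ≠ x₁ → x₀ ≠ x₂ → x₁ ≠ x₂ →
        ∀ x : {x : Fin r // U x = U m}, x = x₀ ∨ x = x₁ ∨ x = x₂ := by
      intro hle3 x₀ x₁ x₂ h01 h02 h12 x
      have n01 : x₀.1 ≠ x₁.1 := fun h => h01 (Subtype.ext h)
      have n02 : x₀.1 ≠ x₂.1 := fun h => h02 (Subtype.ext h)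
      have n12 : x₁.1 ≠ x₂.1 := fun h => h12 (Subtype.ext h)
      have hF : ({x₀.1, x₁.1, x₂.1} : Finset (Fin r)) = Finset.univ.filter fun y : Fin r => is y = is m :=
        Finset.eq_of_subset_of_card_le (fun y hy => by simp only [Finset.mem_insert, Finset.mem_singleton] at hy; rcases hy with rfl | rfl | rfl <;> exact hmemF _)
          (by rw [Finset.card_eq_three.2 ⟨_, _, _, n01, n02, n12, rfl⟩]; exact hle3)
      have hx := hmemF x
      rw [← hF, Finset.mem_insert, Finset.mem_insert, Finset.mem_singleton] at hx
      rcases hx with h | h | h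
      exacts [Or.inl (Subtype.ext h), Or.inr (Or.inl (Subtype.ext h)), Or.inr (Or.inr (Subtype.ext h))]
    by_cases hc2 : (Finset.univ.filter fun x : Fin r => is x = is m).card ≤ 2
    · -- exactly two slots: Shimura + U1's two-set lemma
      have huniv : ∀ x : {x : Fin r // U x = U m}, x = ⟨m, rfl⟩ ∨ x = ⟨m', hUm'⟩ := by
        intro x
        have hF : ({m, m'} : Finset (Fin r)) = Finset.univ.filter fun y : Fin r => is y = is m :=
          Finset.eq_of_subset_of_card_le (fun y hy => by
              simp only [Finset.mem_insert, Finset.mem_singleton] at hy; simp only [Finset.mem_filter, Finset.mem_univ, true_and]; rcases hy with rfl | rfl; exacts [rfl, him])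
            (by rw [Finset.card_pair hm'm.symm]; exact hc2)
        have hx := hmemF x
        rw [← hF, Finset.mem_insert, Finset.mem_singleton] at hx
        rcases hx with h | h
        exacts [Or.inl (Subtype.ext h), Or.inr (Subtype.ext h)]
      have hne := hQne ⟨m, rfl⟩ ⟨m', hUm'⟩ (fun h => hm'm (congrArg Subtype.val h))
      exact linearIndependent_cells_of_two ⟨m, rfl⟩ ⟨m', hUm'⟩ (fun h => hm'm.symm (congrArg Subtype.val h)) huniv Q
        (fun x => (hP0 x.1).image _) (fun x => by rw [hQcard, ← hcard, ← hnn (hix x)]; exact hPn x.1) hne.1 hne.2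
    · push Not at hc2
      have hn3 : nI (is m) ≠ 3 := fun h3 => by have := hfib m; rw [if_pos h3] at this; omega
      have hle3 : (Finset.univ.filter fun x : Fin r => is x = is m).card ≤ 3 := by have := hfib m; rwa [if_neg hn3] at this
      rcases hnI m with h3 | h4 | h5
      · exact absurd h3 hn3
      · -- three slots over one octic field: `p ∈ {1, 2}` on the unit
        have hp12 : ∀ x : {x : Fin r // U x = U m}, p x.1 = 1 ∨ p x.1 = 2 := fun x => by
          rcases hnp x.1 with ⟨h, -⟩ | ⟨-, h⟩ | ⟨-, h⟩ | ⟨h, -⟩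
          · rw [hix x] at h; omega
          · exact Or.inl h
          · exact Or.inr h
          · rw [hix x] at h; omega
        -- the original count of a slot with `p = 2` is `2`, and conversely
        have hcnt2 : ∀ x : {x : Fin r // U x = U m}, p x.1 = 2 ↔
            (Finset.univ.filter fun s : Kf (is x.1) →+* ℂ => s.comp (im x.1) = τ ∧ s ∈ (Φ x.1.succ).1).card = 2 := fun x => by
          have h4x : nI (is x.1) = 4 := by rw [hix x]; exact h4
          constructor
          · intro h2; rcases hor x.1 with hc | hc <;> omega
          · intro hc2'; rcases hp12 x with h1 | h2
            · exfalso; rcases hor x.1 with hc | hc <;> omega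
            · exact h2
        by_cases hall1 : ∀ x : {x : Fin r // U x = U m}, p x.1 = 1
        · -- three `(1,3)`-classes: three distinct singletons and a fourth letter (U2 §2)
          have hsing : ∀ x : {x : Fin r // U x = U m}, ∃ a, Q x = {a} := fun x => Finset.card_eq_one.1 (by rw [hQcard, hall1 x])
          choose qx hqx using hsing
          refine linearIndependent_cells_of_singletons Q _ qx hqx (fun x => by rw [hqx, Finset.card_singleton]) (fun x y hxy => ?_) ?_
          · by_contra hne
            exact (hQne x y (fun h => hne h.symm)).1 (by rw [hqx y, hqx x, hxy])
          · by_contra hall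
            push Not at hall
            have hsurj : Function.Surjective qx := fun y => by obtain ⟨x, hx⟩ := hall y; exact ⟨x, hx⟩
            have := Fintype.card_le_of_surjective _ hsurj
            rw [Fintype.card_fin, hcardU m, h4] at this
            omega
        · -- a `(2,2)`-class is present, hence (h22) a second one
          push Not at hall1
          obtain ⟨x₀, hx₀⟩ := hall1
          have hpx₀ : p x₀.1 = 2 := (hp12 x₀).resolve_left hx₀
          have hFx₀ : (Finset.univ.filter fun y : Fin r => is y = is x₀.1) = Finset.univ.filter fun y : Fin r => is y = is m := by
            ext y; simp only [Finset.mem_filter, Finset.mem_univ, true_and, hix x₀]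
          obtain ⟨y₁, hy₁ne, hy₁is, hy₁cnt⟩ := h22 x₀.1 (by rw [hix x₀]; exact h4) (by rw [hFx₀]; exact hc2) ((hcnt2 x₀).1 hpx₀)
          let x₁ : {x : Fin r // U x = U m} := ⟨y₁, (hU m y₁).2 (hy₁is.trans (hix x₀))⟩
          have hpx₁ : p x₁.1 = 2 := (hcnt2 x₁).2 hy₁cnt
          have h01 : x₀ ≠ x₁ := fun h => hy₁ne (congrArg Subtype.val h).symm
          have hint : ∀ x x' : {x : Fin r // U x = U m}, x ≠ x' → p x.1 = 2 → p x'.1 = 2 → (Q x ∩ Q x').card = 1 := fun x x' hne hx hx' =>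
            card_inter_eq_one_of_four h4 (by rw [hQcard, hx]) (by rw [hQcard, hx']) (hQne x x' (Ne.symm hne)).1 (hQne x x' (Ne.symm hne)).2
          by_cases hall2 : ∀ x : {x : Fin r // U x = U m}, p x.1 = 2
          · -- three `(2,2)`-classes: pairwise orthogonal (U5a)
            exact linearIndependent_cells_of_pairs_meeting_once h4 Q (fun x => by rw [hQcard, hall2 x]) fun x x' hne => hint x x' hne (hall2 x) (hall2 x')
          · -- two `(2,2)`-classes and one `(1,3)`-class (U5a)
            push Not at hall2
            obtain ⟨x₂, hx₂⟩ := hall2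
            have hpx₂ : p x₂.1 = 1 := (hp12 x₂).resolve_right hx₂
            have h02 : x₀ ≠ x₂ := fun h => by rw [h] at hpx₀; omega
            have h12 : x₁ ≠ x₂ := fun h => by rw [h] at hpx₁; omega
            exact linearIndependent_cells_of_two_pairs_singleton h4 x₀ x₁ x₂ h01 h02 h12 (henum hle3 x₀ x₁ x₂ h01 h02 h12) Q
              (by rw [hQcard, hpx₀]) (by rw [hQcard, hpx₁]) (by rw [hQcard, hpx₂]) (hint x₀ x₁ h01 hpx₀ hpx₁)
      · -- three slots over one decic field: three distinct `2`-sets on five letters (U5a)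
        obtain ⟨a, b, c, ha, hb, hc, hab, hac, hbc⟩ := Finset.two_lt_card_iff.1 hc2
        have hmk : ∀ y : Fin r, y ∈ (Finset.univ.filter fun y : Fin r => is y = is m) → U y = U m := fun y hy =>
          (hU m y).2 (Finset.mem_filter.1 hy).2
        have hp5 : ∀ x : {x : Fin r // U x = U m}, p x.1 = 2 := fun x => by
          rcases hnp x.1 with ⟨h, -⟩ | ⟨h, -⟩ | ⟨h, -⟩ | ⟨-, h⟩
          · rw [hix x] at h; omega
          · rw [hix x] at h; omega
          · rw [hix x] at h; omega
          · exact h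
        have hab' : (⟨a, hmk a ha⟩ : {x : Fin r // U x = U m}) ≠ ⟨b, hmk b hb⟩ := fun h => hab (congrArg Subtype.val h)
        have hac' : (⟨a, hmk a ha⟩ : {x : Fin r // U x = U m}) ≠ ⟨c, hmk c hc⟩ := fun h => hac (congrArg Subtype.val h)
        have hbc' : (⟨b, hmk b hb⟩ : {x : Fin r // U x = U m}) ≠ ⟨c, hmk c hc⟩ := fun h => hbc (congrArg Subtype.val h)
        exact linearIndependent_cells_of_three_pairs_five h5 ⟨a, hmk a ha⟩ ⟨b, hmk b hb⟩ ⟨c, hmk c hc⟩ hab' hac' hbc' (henum hle3 _ _ _ hab' hac' hbc') Q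
          (by rw [hQcard, hp5]) (by rw [hQcard, hp5]) (by rw [hQcard, hp5]) (hQne _ _ hab'.symm).1 (hQne _ _ hac'.symm).1 (hQne _ _ hbc'.symm).1
  -- (10) the engine with units and the slot menu; the single-slot Weil spaces from Markman's theorems
  exact hodgeConjectureFor_biproduct_comp_of_units_frames (is := is) (n := fun m => nI (is m)) P p hcard
    (fun m => by rcases hnp m with ⟨-, h⟩ | ⟨-, h⟩ | ⟨-, h⟩ | ⟨-, h⟩ <;> rw [h] <;> norm_num)
    (fun m => by rcases hnp m with ⟨h, h'⟩ | ⟨h, h'⟩ | ⟨h, h'⟩ | ⟨h, h'⟩ <;> rw [h, h'] <;> norm_num)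
    κ h2 im hτ hA' e he_sign he_conj hΨ' hΦ U (fun m m' h => hnn ((hU m m').1 h)) hdg h2t hstab hli hkind
    fun m => weilHyp_of_markman_intrinsic hW4 hM6 m (hnp m) (hdeg m) h2 hd hδ hA' hΨ' (hp m)

end UnitsMenu

end Summit.HodgeConjecture.CorCM.MultiFieldWeil

end
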